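import Summits.BirchSwinnertonDyer.Rank1Residual.X9.TransportHasseWeil
import Summits.BirchSwinnertonDyer.Rank1Residual.X9.TransportSweepE
import Summits.BirchSwinnertonDyer.Rank1Residual.X9.TransportSweepF
import Summits.BirchSwinnertonDyer.Rank1Residual.X9.TransportSweepG
import HarnessLib

/-!
# Class X9, `p = 5`: congruence-transport records RE-KEYED on the Hasse–Weil twin of Kraus–Oesterlé Prop. 4 — part C (6 records; KO92 R-20 repair, step 2)

HONEST FRAMING (cell `b2b-bsdres-*`, verbatim): the cell deletes COMBINATION-SHAPED residual classes of
the rank-≤1 BSD formula from PUBLISHED theorems only and TYPES the construction-shaped remainder; this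
is not "finishing BSD". Class X9 (good ordinary `p ≥ 5`, `ρ̄_{E,p}` irreducible and not surjective) stays
TYPED at class level; everything here is PER PAIR (or generic); no lane verdict is changed; no named fact is
introduced; nothing is booked by this unit (the lane books, the referee rules). Unit `b2b-bsdres-x9`, gen 47.

## Why (the KO92 clause defect, ARM-P register R-20 `KO92-Prop4-(ii)b-frobeniusTrace-offset`, 2026-08-27)

The cited-facts audit (`pub/bsd-cited`, sheet `D-AUDIT-r07-Q41-KO92-LS18.md`) found that
`KrausOesterle1992.prop4_torsionIso_of_congruences` types Prop. 4 (ii)'s clause "`ℓ ∣ NN'`, `ℓ² ∤ NN'` ⇒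
`a_ℓ a'_ℓ ≡ ℓ + 1 (mod p)`" over the tree's `frobeniusTrace`, which at the multiplicative curve of such a pair is
`2` / `0` (`= 1 + a_ℓ`; `X11b.LocalTorsion.frobeniusTrace_eq_two_of_split` / `…_zero_of_nonsplit`), not the
Hasse–Weil `a_ℓ = ±1` the paper multiplies (Math. Ann. 293, p. 263 L8–9). Every X9 congruence-transport record displays
that list on a pair whose `N_E·N_A` has a simple prime far below `μ(M)/6` (x9 GEN 47 owner census: 35 / 35 EXPOSED),
so each is VACUOUS AS TYPED, while its two-engine certificate (Hasse–Weil `a_ℓ`) stands. The typing layer lands the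
corrected twin `KrausOesterle1992.prop4_torsionIso_of_congruences_hasseWeil` (target T-Q41-1; the `= 1 →` conjunct over
`W.LFunction ℓ * W'.LFunction ℓ`, Mathlib's `WeierstrassCurve.LFunction` having the Hasse–Weil `a_ℓ` as prime
coefficient at EVERY prime); the X9 lane re-keys its consumers on it: step 0 `X9/TransportTorsionIso.lean` (p494287,
consumers keyed on the isomorphism), step 1 `X9/TransportHasseWeil.lean` (generic), step 2 these record files.

## Records in this part (each = the original's statement with `hKO` := the twin and ONE token in `hcong`; proof = the original's, through the `_hasseWeil` generic layer; the originals stay in the tree byte-identical — their status as closed statements is ARM-P target T-Q41-2's, not this lane's)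

* `bsdp_t291312bv1_of_bsdp_s41616ck1_hasseWeil` ← `X9/TransportSweepE.lean`'s `bsdp_t291312bv1_of_bsdp_s41616ck1` (291312bv1 ← 41616ck1; exposing prime(s) 7)
* `bsdp_t383292bb1_of_bsdp_s54756h1_hasseWeil` ← `X9/TransportSweepF.lean`'s `bsdp_t383292bb1_of_bsdp_s54756h1` (383292bb1 ← 54756h1; exposing prime(s) 7)
* `bsdp_t383292g1_of_bsdp_s54756f1_hasseWeil` ← `X9/TransportSweepF.lean`'s `bsdp_t383292g1_of_bsdp_s54756f1` (383292g1 ← 54756f1; exposing prime(s) 7)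
* `bsdp_t424536dw1_of_bsdp_s141512bc1_hasseWeil` ← `X9/TransportSweepF.lean`'s `bsdp_t424536dw1_of_bsdp_s141512bc1` (424536dw1 ← 141512bc1; exposing prime(s) 3)
* `bsdp_t441864bn1_of_bsdp_s25992q1_hasseWeil` ← `X9/TransportSweepG.lean`'s `bsdp_t441864bn1_of_bsdp_s25992q1` (441864bn1 ← 25992q1; exposing prime(s) 17)
* `bsdp_t441864bo1_of_bsdp_s25992c1_hasseWeil` ← `X9/TransportSweepG.lean`'s `bsdp_t441864bo1_of_bsdp_s25992c1` (441864bo1 ← 25992c1; exposing prime(s) 17)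

No certificate is recomputed: the engines (PARI `ellap`; ENGINE D) computed Hasse–Weil `a_ℓ` — print's clause — in the kits named
in each docstring. References: as in the original files; Kraus–Oesterlé, Math. Ann. 293 (1992) Prop. 4 (ii), pp. 263–264.
-/

set_option autoImplicit false

noncomputable section

open scoped Classical MatrixGroups ModularForm

open CongruenceSubgroup WeierstrassCurve Literature.NumberTheory.EllipticCurves
  Literature.NumberTheory.EllipticCurves.ModularForms Literature.NumberTheory.EllipticCurves.Rank1Residual
  Literature.NumberTheory.EllipticCurves.Rank1Residual.Typed
  Literature.NumberTheory.EllipticCurves.Rank1Residual.X11RankOneCertificates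
  Summit.BirchSwinnertonDyer.BirchSwinnertonDyer.Rank1Residual.IntModel
  Summit.BirchSwinnertonDyer.BirchSwinnertonDyer.Rank1Residual.X11RankOne
  Summit.BirchSwinnertonDyer.Rank1Residual.X11b

namespace Summit.BirchSwinnertonDyer.Rank1Residual.X9

/-! ### The re-keyed records -/

/-- **`BSD(E,5)`-side record for `291312bv1` from `41616ck1`, RE-KEYED on the Hasse–Weil twin of Kraus–Oesterlé Prop. 4** (ARM-P register
R-20 `KO92-Prop4-(ii)b-frobeniusTrace-offset`; x9 GEN 47 census `HOME/b2b-bsdres-x9/g47/KO92-EXPOSURE-X9.md`): the record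
`bsdp_t291312bv1_of_bsdp_s41616ck1` of `X9/TransportSweepE.lean` — same Cremona models, same kernel-decided data (its `card_*` / `isElliptic_*` /
`isGloballyMinimal_*` theorems are imported, not re-proved), same PUBLISHED and FINITE binders (see that docstring for every number) —
with (i) `hKO` := the corrected statement `KrausOesterle1992.prop4_torsionIso_of_congruences_hasseWeil` and (ii) the `v_ℓ(N_E N_A) = 1`
conjunct of the displayed list `hcong` over `W.LFunction ℓ * A.LFunction ℓ` — Mathlib's `WeierstrassCurve.LFunction`, whose prime
coefficient is the HASSE–WEIL `a_ℓ`, `= ±1` at the multiplicative curve (Kraus–Oesterlé, Math. Ann. 293, p. 263 L8–9) — instead of the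
tree's `frobeniusTrace` (`= 2 / 0` there, `X11b.LocalTorsion.frobeniusTrace_eq_two_of_split` / `…_zero_of_nonsplit`), which made the
original's `hcong` unsatisfiable at the simple prime(s) ℓ ∈ {7} of `N_E·N_A` and the original VACUOUS AS TYPED. Hasse–Weil `a_ℓ` is the
currency in which the two engines (PARI `ellap`; ENGINE D pure-Python BSGS/Mestre; kit j130867) CERTIFIED the list: no certificate changes.
Per pair; nothing booked; X9 stays typed. [cite: KrausOesterle1992, Prop. 4 (ii), pp. 263–264] [cite: GreenbergVatsal2000, Thm. (1.4) (arXiv p. 5)]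
[cite: Cremona2006, Table 1 (Cremona labels 291312bv1, 41616ck1)] -/
theorem bsdp_t291312bv1_of_bsdp_s41616ck1_hasseWeil
    (hKO : KrausOesterle1992.prop4_torsionIso_of_congruences_hasseWeil)
    (hBCS : burungale_castella_skinner_charIdeal_eq_padicLFunction)
    (hGr : greenberg_charValue_rankZero) (h5 : realPeriodRat_eq_unit_mul_plusPeriod)
    (hGV : GreenbergVatsal2000.thm14_mainConjecture_transfer_of_torsionIso)
    (hS : Schneider1985_order_charGenerator) (hPR : perrinRiou_rankOne_leadingTerms)
    (hmodP : nonempty_modularParametrizationData) (hmodL : hasEntireLFunction_rat)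
    (hGZK : rank_eq_analyticRank_of_analyticRank_le_one)
    (W A : WeierstrassCurve ℚ) [W.IsElliptic] [W.IsGloballyMinimal] [A.IsElliptic] [A.IsGloballyMinimal]
    [Fact (Nat.Prime 5)]
    (hW : W = ⟨0, 0, 0, -9270831, 10169015834⟩) (hA : A = ⟨0, 0, 0, 204, 799⟩)
    (hran : W.analyticRank ≤ 1) (hrA : A.analyticRank ≤ 1) (hbsdA : BSDp A 5)
    (hSchA : A.analyticRank = 1 → ∀ Dh : PAdicHeightData A 5, Dh.IsCanonical → SchneiderConjecture Dh)
    (hcertA : ∀ [NeZero (A.conductorNorm ℤ)] (fA : CuspForm (Gamma0 (A.conductorNorm ℤ)) 2),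
        IsNewformOf A fA → ∀ (ϖ : ℚ), (ϖ : ℝ) * A.realPeriodRat = plusPeriod fA →
      ∃ n : ℕ, ‖PowerSeries.coeff n
        (PowerSeries.C (ϖ : ℚ_[5]) * padicLFunction fA (unitRoot A 5 : ℚ_[5]))‖ = 1)
    (hcong : ∀ (ℓ : ℕ) [Fact ℓ.Prime],
      6 * ℓ < KrausOesterle1992.gammaZeroIndex (KrausOesterle1992.modulus W A) →
      (padicValNat ℓ (W.conductorNorm ℤ * A.conductorNorm ℤ) = 0 →
          (5 : ℤ) ∣ W.frobeniusTrace ℓ - A.frobeniusTrace ℓ) ∧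
        (padicValNat ℓ (W.conductorNorm ℤ * A.conductorNorm ℤ) = 1 →
          (5 : ℤ) ∣ W.LFunction ℓ * A.LFunction ℓ - (ℓ + 1)))
    (hC3 : W.analyticRank = 1 → ∀ Dh : PAdicHeightData W 5, Dh.IsCanonical → SchneiderConjecture Dh) :
    BSDp W 5 := by
  have hIW : integralModelInt W = ⟨0, 0, 0, -9270831, 10169015834⟩ :=
    integralModelInt_eq_of_map_eq _ (by rw [hW]; ext <;> simp [WeierstrassCurve.map])
  have hIA : integralModelInt A = ⟨0, 0, 0, 204, 799⟩ :=
    integralModelInt_eq_of_map_eq _ (by rw [hA]; ext <;> simp [WeierstrassCurve.map])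
  haveI : Fact (Nat.Prime 11) := ⟨by norm_num⟩
  exact bsdp_of_ainvs_of_bsdpPartner_of_congruences_of_analyticRank_le_one_hasseWeil hKO hBCS hGr h5 hGV hS hPR hmodP hmodL hGZK
    0 0 0 (-9270831) 10169015834 hIW
    0 0 0 204 799 hIA
    5 11 8 8 8 (by norm_num) (by decide +kernel) card_t291312bv1_5 (by decide) (by decide)
    (by decide +kernel) card_t291312bv1_11 (by decide) (by decide +kernel) card_s41616ck1_5 (by decide)
    hran hrA hbsdA hSchA hcertA hcong hC3

/-- **`BSD(E,5)`-side record for `383292bb1` from `54756h1`, RE-KEYED on the Hasse–Weil twin of Kraus–Oesterlé Prop. 4** (ARM-P register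
R-20 `KO92-Prop4-(ii)b-frobeniusTrace-offset`; x9 GEN 47 census `HOME/b2b-bsdres-x9/g47/KO92-EXPOSURE-X9.md`): the record
`bsdp_t383292bb1_of_bsdp_s54756h1` of `X9/TransportSweepF.lean` — same Cremona models, same kernel-decided data (its `card_*` / `isElliptic_*` /
`isGloballyMinimal_*` theorems are imported, not re-proved), same PUBLISHED and FINITE binders (see that docstring for every number) —
with (i) `hKO` := the corrected statement `KrausOesterle1992.prop4_torsionIso_of_congruences_hasseWeil` and (ii) the `v_ℓ(N_E N_A) = 1`
conjunct of the displayed list `hcong` over `W.LFunction ℓ * A.LFunction ℓ` — Mathlib's `WeierstrassCurve.LFunction`, whose prime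
coefficient is the HASSE–WEIL `a_ℓ`, `= ±1` at the multiplicative curve (Kraus–Oesterlé, Math. Ann. 293, p. 263 L8–9) — instead of the
tree's `frobeniusTrace` (`= 2 / 0` there, `X11b.LocalTorsion.frobeniusTrace_eq_two_of_split` / `…_zero_of_nonsplit`), which made the
original's `hcong` unsatisfiable at the simple prime(s) ℓ ∈ {7} of `N_E·N_A` and the original VACUOUS AS TYPED. Hasse–Weil `a_ℓ` is the
currency in which the two engines (PARI `ellap`; ENGINE D pure-Python BSGS/Mestre; kit j130867) CERTIFIED the list: no certificate changes.
Per pair; nothing booked; X9 stays typed. [cite: KrausOesterle1992, Prop. 4 (ii), pp. 263–264] [cite: GreenbergVatsal2000, Thm. (1.4) (arXiv p. 5)]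
[cite: Cremona2006, Table 1 (Cremona labels 383292bb1, 54756h1)] -/
theorem bsdp_t383292bb1_of_bsdp_s54756h1_hasseWeil
    (hKO : KrausOesterle1992.prop4_torsionIso_of_congruences_hasseWeil)
    (hBCS : burungale_castella_skinner_charIdeal_eq_padicLFunction)
    (hGr : greenberg_charValue_rankZero) (h5 : realPeriodRat_eq_unit_mul_plusPeriod)
    (hGV : GreenbergVatsal2000.thm14_mainConjecture_transfer_of_torsionIso)
    (hS : Schneider1985_order_charGenerator) (hPR : perrinRiou_rankOne_leadingTerms)
    (hmodP : nonempty_modularParametrizationData) (hmodL : hasEntireLFunction_rat)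
    (hGZK : rank_eq_analyticRank_of_analyticRank_le_one)
    (W A : WeierstrassCurve ℚ) [W.IsElliptic] [W.IsGloballyMinimal] [A.IsElliptic] [A.IsGloballyMinimal]
    [Fact (Nat.Prime 5)]
    (hW : W = ⟨0, 0, 0, -196209, 36006633⟩) (hA : A = ⟨0, 0, 0, 1521, -39546⟩)
    (hran : W.analyticRank ≤ 1) (hrA : A.analyticRank ≤ 1) (hbsdA : BSDp A 5)
    (hSchA : A.analyticRank = 1 → ∀ Dh : PAdicHeightData A 5, Dh.IsCanonical → SchneiderConjecture Dh)
    (hcertA : ∀ [NeZero (A.conductorNorm ℤ)] (fA : CuspForm (Gamma0 (A.conductorNorm ℤ)) 2),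
        IsNewformOf A fA → ∀ (ϖ : ℚ), (ϖ : ℝ) * A.realPeriodRat = plusPeriod fA →
      ∃ n : ℕ, ‖PowerSeries.coeff n
        (PowerSeries.C (ϖ : ℚ_[5]) * padicLFunction fA (unitRoot A 5 : ℚ_[5]))‖ = 1)
    (hcong : ∀ (ℓ : ℕ) [Fact ℓ.Prime],
      6 * ℓ < KrausOesterle1992.gammaZeroIndex (KrausOesterle1992.modulus W A) →
      (padicValNat ℓ (W.conductorNorm ℤ * A.conductorNorm ℤ) = 0 →
          (5 : ℤ) ∣ W.frobeniusTrace ℓ - A.frobeniusTrace ℓ) ∧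
        (padicValNat ℓ (W.conductorNorm ℤ * A.conductorNorm ℤ) = 1 →
          (5 : ℤ) ∣ W.LFunction ℓ * A.LFunction ℓ - (ℓ + 1)))
    (hC3 : W.analyticRank = 1 → ∀ Dh : PAdicHeightData W 5, Dh.IsCanonical → SchneiderConjecture Dh) :
    BSDp W 5 := by
  have hIW : integralModelInt W = ⟨0, 0, 0, -196209, 36006633⟩ :=
    integralModelInt_eq_of_map_eq _ (by rw [hW]; ext <;> simp [WeierstrassCurve.map])
  have hIA : integralModelInt A = ⟨0, 0, 0, 1521, -39546⟩ :=
    integralModelInt_eq_of_map_eq _ (by rw [hA]; ext <;> simp [WeierstrassCurve.map])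
  haveI : Fact (Nat.Prime 11) := ⟨by norm_num⟩
  exact bsdp_of_ainvs_of_bsdpPartner_of_congruences_of_analyticRank_le_one_hasseWeil hKO hBCS hGr h5 hGV hS hPR hmodP hmodL hGZK
    0 0 0 (-196209) 36006633 hIW
    0 0 0 1521 (-39546) hIA
    5 11 11 4 9 (by norm_num) (by decide +kernel) card_t383292bb1_5 (by decide) (by decide)
    (by decide +kernel) card_t383292bb1_11 (by decide) (by decide +kernel) card_s54756h1_5 (by decide)
    hran hrA hbsdA hSchA hcertA hcong hC3

/-- **`BSD(E,5)`-side record for `383292g1` from `54756f1`, RE-KEYED on the Hasse–Weil twin of Kraus–Oesterlé Prop. 4** (ARM-P register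
R-20 `KO92-Prop4-(ii)b-frobeniusTrace-offset`; x9 GEN 47 census `HOME/b2b-bsdres-x9/g47/KO92-EXPOSURE-X9.md`): the record
`bsdp_t383292g1_of_bsdp_s54756f1` of `X9/TransportSweepF.lean` — same Cremona models, same kernel-decided data (its `card_*` / `isElliptic_*` /
`isGloballyMinimal_*` theorems are imported, not re-proved), same PUBLISHED and FINITE binders (see that docstring for every number) —
with (i) `hKO` := the corrected statement `KrausOesterle1992.prop4_torsionIso_of_congruences_hasseWeil` and (ii) the `v_ℓ(N_E N_A) = 1`
conjunct of the displayed list `hcong` over `W.LFunction ℓ * A.LFunction ℓ` — Mathlib's `WeierstrassCurve.LFunction`, whose prime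
coefficient is the HASSE–WEIL `a_ℓ`, `= ±1` at the multiplicative curve (Kraus–Oesterlé, Math. Ann. 293, p. 263 L8–9) — instead of the
tree's `frobeniusTrace` (`= 2 / 0` there, `X11b.LocalTorsion.frobeniusTrace_eq_two_of_split` / `…_zero_of_nonsplit`), which made the
original's `hcong` unsatisfiable at the simple prime(s) ℓ ∈ {7} of `N_E·N_A` and the original VACUOUS AS TYPED. Hasse–Weil `a_ℓ` is the
currency in which the two engines (PARI `ellap`; ENGINE D pure-Python BSGS/Mestre; kit j130867) CERTIFIED the list: no certificate changes.
Per pair; nothing booked; X9 stays typed. [cite: KrausOesterle1992, Prop. 4 (ii), pp. 263–264] [cite: GreenbergVatsal2000, Thm. (1.4) (arXiv p. 5)]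
[cite: Cremona2006, Table 1 (Cremona labels 383292g1, 54756f1)] -/
theorem bsdp_t383292g1_of_bsdp_s54756f1_hasseWeil
    (hKO : KrausOesterle1992.prop4_torsionIso_of_congruences_hasseWeil)
    (hBCS : burungale_castella_skinner_charIdeal_eq_padicLFunction)
    (hGr : greenberg_charValue_rankZero) (h5 : realPeriodRat_eq_unit_mul_plusPeriod)
    (hGV : GreenbergVatsal2000.thm14_mainConjecture_transfer_of_torsionIso)
    (hS : Schneider1985_order_charGenerator) (hPR : perrinRiou_rankOne_leadingTerms)
    (hmodP : nonempty_modularParametrizationData) (hmodL : hasEntireLFunction_rat)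
    (hGZK : rank_eq_analyticRank_of_analyticRank_le_one)
    (W A : WeierstrassCurve ℚ) [W.IsElliptic] [W.IsGloballyMinimal] [A.IsElliptic] [A.IsGloballyMinimal]
    [Fact (Nat.Prime 5)]
    (hW : W = ⟨0, 0, 0, -21801, -1333579⟩) (hA : A = ⟨0, 0, 0, -6591, 206518⟩)
    (hran : W.analyticRank ≤ 1) (hrA : A.analyticRank ≤ 1) (hbsdA : BSDp A 5)
    (hSchA : A.analyticRank = 1 → ∀ Dh : PAdicHeightData A 5, Dh.IsCanonical → SchneiderConjecture Dh)
    (hcertA : ∀ [NeZero (A.conductorNorm ℤ)] (fA : CuspForm (Gamma0 (A.conductorNorm ℤ)) 2),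
        IsNewformOf A fA → ∀ (ϖ : ℚ), (ϖ : ℝ) * A.realPeriodRat = plusPeriod fA →
      ∃ n : ℕ, ‖PowerSeries.coeff n
        (PowerSeries.C (ϖ : ℚ_[5]) * padicLFunction fA (unitRoot A 5 : ℚ_[5]))‖ = 1)
    (hcong : ∀ (ℓ : ℕ) [Fact ℓ.Prime],
      6 * ℓ < KrausOesterle1992.gammaZeroIndex (KrausOesterle1992.modulus W A) →
      (padicValNat ℓ (W.conductorNorm ℤ * A.conductorNorm ℤ) = 0 →
          (5 : ℤ) ∣ W.frobeniusTrace ℓ - A.frobeniusTrace ℓ) ∧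
        (padicValNat ℓ (W.conductorNorm ℤ * A.conductorNorm ℤ) = 1 →
          (5 : ℤ) ∣ W.LFunction ℓ * A.LFunction ℓ - (ℓ + 1)))
    (hC3 : W.analyticRank = 1 → ∀ Dh : PAdicHeightData W 5, Dh.IsCanonical → SchneiderConjecture Dh) :
    BSDp W 5 := by
  have hIW : integralModelInt W = ⟨0, 0, 0, -21801, -1333579⟩ :=
    integralModelInt_eq_of_map_eq _ (by rw [hW]; ext <;> simp [WeierstrassCurve.map])
  have hIA : integralModelInt A = ⟨0, 0, 0, -6591, 206518⟩ :=
    integralModelInt_eq_of_map_eq _ (by rw [hA]; ext <;> simp [WeierstrassCurve.map])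
  haveI : Fact (Nat.Prime 11) := ⟨by norm_num⟩
  exact bsdp_of_ainvs_of_bsdpPartner_of_congruences_of_analyticRank_le_one_hasseWeil hKO hBCS hGr h5 hGV hS hPR hmodP hmodL hGZK
    0 0 0 (-21801) (-1333579) hIW
    0 0 0 (-6591) 206518 hIA
    5 11 13 8 3 (by norm_num) (by decide +kernel) card_t383292g1_5 (by decide) (by decide)
    (by decide +kernel) card_t383292g1_11 (by decide) (by decide +kernel) card_s54756f1_5 (by decide)
    hran hrA hbsdA hSchA hcertA hcong hC3

/-- **`BSD(E,5)`-side record for `424536dw1` from `141512bc1`, RE-KEYED on the Hasse–Weil twin of Kraus–Oesterlé Prop. 4** (ARM-P register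
R-20 `KO92-Prop4-(ii)b-frobeniusTrace-offset`; x9 GEN 47 census `HOME/b2b-bsdres-x9/g47/KO92-EXPOSURE-X9.md`): the record
`bsdp_t424536dw1_of_bsdp_s141512bc1` of `X9/TransportSweepF.lean` — same Cremona models, same kernel-decided data (its `card_*` / `isElliptic_*` /
`isGloballyMinimal_*` theorems are imported, not re-proved), same PUBLISHED and FINITE binders (see that docstring for every number) —
with (i) `hKO` := the corrected statement `KrausOesterle1992.prop4_torsionIso_of_congruences_hasseWeil` and (ii) the `v_ℓ(N_E N_A) = 1`
conjunct of the displayed list `hcong` over `W.LFunction ℓ * A.LFunction ℓ` — Mathlib's `WeierstrassCurve.LFunction`, whose prime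
coefficient is the HASSE–WEIL `a_ℓ`, `= ±1` at the multiplicative curve (Kraus–Oesterlé, Math. Ann. 293, p. 263 L8–9) — instead of the
tree's `frobeniusTrace` (`= 2 / 0` there, `X11b.LocalTorsion.frobeniusTrace_eq_two_of_split` / `…_zero_of_nonsplit`), which made the
original's `hcong` unsatisfiable at the simple prime(s) ℓ ∈ {3} of `N_E·N_A` and the original VACUOUS AS TYPED. Hasse–Weil `a_ℓ` is the
currency in which the two engines (PARI `ellap`; ENGINE D pure-Python BSGS/Mestre; kit j130867) CERTIFIED the list: no certificate changes.
Per pair; nothing booked; X9 stays typed. [cite: KrausOesterle1992, Prop. 4 (ii), pp. 263–264] [cite: GreenbergVatsal2000, Thm. (1.4) (arXiv p. 5)]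
[cite: Cremona2006, Table 1 (Cremona labels 424536dw1, 141512bc1)] -/
theorem bsdp_t424536dw1_of_bsdp_s141512bc1_hasseWeil
    (hKO : KrausOesterle1992.prop4_torsionIso_of_congruences_hasseWeil)
    (hBCS : burungale_castella_skinner_charIdeal_eq_padicLFunction)
    (hGr : greenberg_charValue_rankZero) (h5 : realPeriodRat_eq_unit_mul_plusPeriod)
    (hGV : GreenbergVatsal2000.thm14_mainConjecture_transfer_of_torsionIso)
    (hS : Schneider1985_order_charGenerator) (hPR : perrinRiou_rankOne_leadingTerms)
    (hmodP : nonempty_modularParametrizationData) (hmodL : hasEntireLFunction_rat)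
    (hGZK : rank_eq_analyticRank_of_analyticRank_le_one)
    (W A : WeierstrassCurve ℚ) [W.IsElliptic] [W.IsGloballyMinimal] [A.IsElliptic] [A.IsGloballyMinimal]
    [Fact (Nat.Prime 5)]
    (hW : W = ⟨0, 1, 0, -784212, 599051088⟩) (hA : A = ⟨0, -1, 0, -7506032, -7912727339⟩)
    (hran : W.analyticRank ≤ 1) (hrA : A.analyticRank ≤ 1) (hbsdA : BSDp A 5)
    (hSchA : A.analyticRank = 1 → ∀ Dh : PAdicHeightData A 5, Dh.IsCanonical → SchneiderConjecture Dh)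
    (hcertA : ∀ [NeZero (A.conductorNorm ℤ)] (fA : CuspForm (Gamma0 (A.conductorNorm ℤ)) 2),
        IsNewformOf A fA → ∀ (ϖ : ℚ), (ϖ : ℝ) * A.realPeriodRat = plusPeriod fA →
      ∃ n : ℕ, ‖PowerSeries.coeff n
        (PowerSeries.C (ϖ : ℚ_[5]) * padicLFunction fA (unitRoot A 5 : ℚ_[5]))‖ = 1)
    (hcong : ∀ (ℓ : ℕ) [Fact ℓ.Prime],
      6 * ℓ < KrausOesterle1992.gammaZeroIndex (KrausOesterle1992.modulus W A) →
      (padicValNat ℓ (W.conductorNorm ℤ * A.conductorNorm ℤ) = 0 →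
          (5 : ℤ) ∣ W.frobeniusTrace ℓ - A.frobeniusTrace ℓ) ∧
        (padicValNat ℓ (W.conductorNorm ℤ * A.conductorNorm ℤ) = 1 →
          (5 : ℤ) ∣ W.LFunction ℓ * A.LFunction ℓ - (ℓ + 1)))
    (hC3 : W.analyticRank = 1 → ∀ Dh : PAdicHeightData W 5, Dh.IsCanonical → SchneiderConjecture Dh) :
    BSDp W 5 := by
  have hIW : integralModelInt W = ⟨0, 1, 0, -784212, 599051088⟩ :=
    integralModelInt_eq_of_map_eq _ (by rw [hW]; ext <;> simp [WeierstrassCurve.map])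
  have hIA : integralModelInt A = ⟨0, -1, 0, -7506032, -7912727339⟩ :=
    integralModelInt_eq_of_map_eq _ (by rw [hA]; ext <;> simp [WeierstrassCurve.map])
  haveI : Fact (Nat.Prime 11) := ⟨by norm_num⟩
  exact bsdp_of_ainvs_of_bsdpPartner_of_congruences_of_analyticRank_le_one_hasseWeil hKO hBCS hGr h5 hGV hS hPR hmodP hmodL hGZK
    0 1 0 (-784212) 599051088 hIW
    0 (-1) 0 (-7506032) (-7912727339) hIA
    5 11 16 4 9 (by norm_num) (by decide +kernel) card_t424536dw1_5 (by decide) (by decide)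
    (by decide +kernel) card_t424536dw1_11 (by decide) (by decide +kernel) card_s141512bc1_5 (by decide)
    hran hrA hbsdA hSchA hcertA hcong hC3

/-- **`BSD(E,5)`-side record for `441864bn1` from `25992q1`, RE-KEYED on the Hasse–Weil twin of Kraus–Oesterlé Prop. 4** (ARM-P register
R-20 `KO92-Prop4-(ii)b-frobeniusTrace-offset`; x9 GEN 47 census `HOME/b2b-bsdres-x9/g47/KO92-EXPOSURE-X9.md`): the record
`bsdp_t441864bn1_of_bsdp_s25992q1` of `X9/TransportSweepG.lean` — same Cremona models, same kernel-decided data (its `card_*` / `isElliptic_*` /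
`isGloballyMinimal_*` theorems are imported, not re-proved), same PUBLISHED and FINITE binders (see that docstring for every number) —
with (i) `hKO` := the corrected statement `KrausOesterle1992.prop4_torsionIso_of_congruences_hasseWeil` and (ii) the `v_ℓ(N_E N_A) = 1`
conjunct of the displayed list `hcong` over `W.LFunction ℓ * A.LFunction ℓ` — Mathlib's `WeierstrassCurve.LFunction`, whose prime
coefficient is the HASSE–WEIL `a_ℓ`, `= ±1` at the multiplicative curve (Kraus–Oesterlé, Math. Ann. 293, p. 263 L8–9) — instead of the
tree's `frobeniusTrace` (`= 2 / 0` there, `X11b.LocalTorsion.frobeniusTrace_eq_two_of_split` / `…_zero_of_nonsplit`), which made the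
original's `hcong` unsatisfiable at the simple prime(s) ℓ ∈ {17} of `N_E·N_A` and the original VACUOUS AS TYPED. Hasse–Weil `a_ℓ` is the
currency in which the two engines (PARI `ellap`; ENGINE D pure-Python BSGS/Mestre; kit j130867) CERTIFIED the list: no certificate changes.
Per pair; nothing booked; X9 stays typed. [cite: KrausOesterle1992, Prop. 4 (ii), pp. 263–264] [cite: GreenbergVatsal2000, Thm. (1.4) (arXiv p. 5)]
[cite: Cremona2006, Table 1 (Cremona labels 441864bn1, 25992q1)] -/
theorem bsdp_t441864bn1_of_bsdp_s25992q1_hasseWeil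
    (hKO : KrausOesterle1992.prop4_torsionIso_of_congruences_hasseWeil)
    (hBCS : burungale_castella_skinner_charIdeal_eq_padicLFunction)
    (hGr : greenberg_charValue_rankZero) (h5 : realPeriodRat_eq_unit_mul_plusPeriod)
    (hGV : GreenbergVatsal2000.thm14_mainConjecture_transfer_of_torsionIso)
    (hS : Schneider1985_order_charGenerator) (hPR : perrinRiou_rankOne_leadingTerms)
    (hmodP : nonempty_modularParametrizationData) (hmodL : hasEntireLFunction_rat)
    (hGZK : rank_eq_analyticRank_of_analyticRank_le_one)
    (W A : WeierstrassCurve ℚ) [W.IsElliptic] [W.IsGloballyMinimal] [A.IsElliptic] [A.IsGloballyMinimal]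
    [Fact (Nat.Prime 5)]
    (hW : W = ⟨0, 0, 0, -3868476, -2993734012⟩) (hA : A = ⟨0, 0, 0, -61731, 5994766⟩)
    (hran : W.analyticRank ≤ 1) (hrA : A.analyticRank ≤ 1) (hbsdA : BSDp A 5)
    (hSchA : A.analyticRank = 1 → ∀ Dh : PAdicHeightData A 5, Dh.IsCanonical → SchneiderConjecture Dh)
    (hcertA : ∀ [NeZero (A.conductorNorm ℤ)] (fA : CuspForm (Gamma0 (A.conductorNorm ℤ)) 2),
        IsNewformOf A fA → ∀ (ϖ : ℚ), (ϖ : ℝ) * A.realPeriodRat = plusPeriod fA →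
      ∃ n : ℕ, ‖PowerSeries.coeff n
        (PowerSeries.C (ϖ : ℚ_[5]) * padicLFunction fA (unitRoot A 5 : ℚ_[5]))‖ = 1)
    (hcong : ∀ (ℓ : ℕ) [Fact ℓ.Prime],
      6 * ℓ < KrausOesterle1992.gammaZeroIndex (KrausOesterle1992.modulus W A) →
      (padicValNat ℓ (W.conductorNorm ℤ * A.conductorNorm ℤ) = 0 →
          (5 : ℤ) ∣ W.frobeniusTrace ℓ - A.frobeniusTrace ℓ) ∧
        (padicValNat ℓ (W.conductorNorm ℤ * A.conductorNorm ℤ) = 1 →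
          (5 : ℤ) ∣ W.LFunction ℓ * A.LFunction ℓ - (ℓ + 1)))
    (hC3 : W.analyticRank = 1 → ∀ Dh : PAdicHeightData W 5, Dh.IsCanonical → SchneiderConjecture Dh) :
    BSDp W 5 := by
  have hIW : integralModelInt W = ⟨0, 0, 0, -3868476, -2993734012⟩ :=
    integralModelInt_eq_of_map_eq _ (by rw [hW]; ext <;> simp [WeierstrassCurve.map])
  have hIA : integralModelInt A = ⟨0, 0, 0, -61731, 5994766⟩ :=
    integralModelInt_eq_of_map_eq _ (by rw [hA]; ext <;> simp [WeierstrassCurve.map])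
  haveI : Fact (Nat.Prime 11) := ⟨by norm_num⟩
  exact bsdp_of_ainvs_of_bsdpPartner_of_congruences_of_analyticRank_le_one_hasseWeil hKO hBCS hGr h5 hGV hS hPR hmodP hmodL hGZK
    0 0 0 (-3868476) (-2993734012) hIW
    0 0 0 (-61731) 5994766 hIA
    5 11 16 3 8 (by norm_num) (by decide +kernel) card_t441864bn1_5 (by decide) (by decide)
    (by decide +kernel) card_t441864bn1_11 (by decide) (by decide +kernel) card_s25992q1_5 (by decide)
    hran hrA hbsdA hSchA hcertA hcong hC3

/-- **`BSD(E,5)`-side record for `441864bo1` from `25992c1`, RE-KEYED on the Hasse–Weil twin of Kraus–Oesterlé Prop. 4** (ARM-P register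
R-20 `KO92-Prop4-(ii)b-frobeniusTrace-offset`; x9 GEN 47 census `HOME/b2b-bsdres-x9/g47/KO92-EXPOSURE-X9.md`): the record
`bsdp_t441864bo1_of_bsdp_s25992c1` of `X9/TransportSweepG.lean` — same Cremona models, same kernel-decided data (its `card_*` / `isElliptic_*` /
`isGloballyMinimal_*` theorems are imported, not re-proved), same PUBLISHED and FINITE binders (see that docstring for every number) —
with (i) `hKO` := the corrected statement `KrausOesterle1992.prop4_torsionIso_of_congruences_hasseWeil` and (ii) the `v_ℓ(N_E N_A) = 1`
conjunct of the displayed list `hcong` over `W.LFunction ℓ * A.LFunction ℓ` — Mathlib's `WeierstrassCurve.LFunction`, whose prime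
coefficient is the HASSE–WEIL `a_ℓ`, `= ±1` at the multiplicative curve (Kraus–Oesterlé, Math. Ann. 293, p. 263 L8–9) — instead of the
tree's `frobeniusTrace` (`= 2 / 0` there, `X11b.LocalTorsion.frobeniusTrace_eq_two_of_split` / `…_zero_of_nonsplit`), which made the
original's `hcong` unsatisfiable at the simple prime(s) ℓ ∈ {17} of `N_E·N_A` and the original VACUOUS AS TYPED. Hasse–Weil `a_ℓ` is the
currency in which the two engines (PARI `ellap`; ENGINE D pure-Python BSGS/Mestre; kit j130867) CERTIFIED the list: no certificate changes.
Per pair; nothing booked; X9 stays typed. [cite: KrausOesterle1992, Prop. 4 (ii), pp. 263–264] [cite: GreenbergVatsal2000, Thm. (1.4) (arXiv p. 5)]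
[cite: Cremona2006, Table 1 (Cremona labels 441864bo1, 25992c1)] -/
theorem bsdp_t441864bo1_of_bsdp_s25992c1_hasseWeil
    (hKO : KrausOesterle1992.prop4_torsionIso_of_congruences_hasseWeil)
    (hBCS : burungale_castella_skinner_charIdeal_eq_padicLFunction)
    (hGr : greenberg_charValue_rankZero) (h5 : realPeriodRat_eq_unit_mul_plusPeriod)
    (hGV : GreenbergVatsal2000.thm14_mainConjecture_transfer_of_torsionIso)
    (hS : Schneider1985_order_charGenerator) (hPR : perrinRiou_rankOne_leadingTerms)
    (hmodP : nonempty_modularParametrizationData) (hmodL : hasEntireLFunction_rat)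
    (hGZK : rank_eq_analyticRank_of_analyticRank_le_one)
    (W A : WeierstrassCurve ℚ) [W.IsElliptic] [W.IsGloballyMinimal] [A.IsElliptic] [A.IsGloballyMinimal]
    [Fact (Nat.Prime 5)]
    (hW : W = ⟨0, 0, 0, -10716, 436468⟩) (hA : A = ⟨0, 0, 0, -171, -874⟩)
    (hran : W.analyticRank ≤ 1) (hrA : A.analyticRank ≤ 1) (hbsdA : BSDp A 5)
    (hSchA : A.analyticRank = 1 → ∀ Dh : PAdicHeightData A 5, Dh.IsCanonical → SchneiderConjecture Dh)
    (hcertA : ∀ [NeZero (A.conductorNorm ℤ)] (fA : CuspForm (Gamma0 (A.conductorNorm ℤ)) 2),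
        IsNewformOf A fA → ∀ (ϖ : ℚ), (ϖ : ℝ) * A.realPeriodRat = plusPeriod fA →
      ∃ n : ℕ, ‖PowerSeries.coeff n
        (PowerSeries.C (ϖ : ℚ_[5]) * padicLFunction fA (unitRoot A 5 : ℚ_[5]))‖ = 1)
    (hcong : ∀ (ℓ : ℕ) [Fact ℓ.Prime],
      6 * ℓ < KrausOesterle1992.gammaZeroIndex (KrausOesterle1992.modulus W A) →
      (padicValNat ℓ (W.conductorNorm ℤ * A.conductorNorm ℤ) = 0 →
          (5 : ℤ) ∣ W.frobeniusTrace ℓ - A.frobeniusTrace ℓ) ∧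
        (padicValNat ℓ (W.conductorNorm ℤ * A.conductorNorm ℤ) = 1 →
          (5 : ℤ) ∣ W.LFunction ℓ * A.LFunction ℓ - (ℓ + 1)))
    (hC3 : W.analyticRank = 1 → ∀ Dh : PAdicHeightData W 5, Dh.IsCanonical → SchneiderConjecture Dh) :
    BSDp W 5 := by
  have hIW : integralModelInt W = ⟨0, 0, 0, -10716, 436468⟩ :=
    integralModelInt_eq_of_map_eq _ (by rw [hW]; ext <;> simp [WeierstrassCurve.map])
  have hIA : integralModelInt A = ⟨0, 0, 0, -171, -874⟩ :=
    integralModelInt_eq_of_map_eq _ (by rw [hA]; ext <;> simp [WeierstrassCurve.map])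
  haveI : Fact (Nat.Prime 11) := ⟨by norm_num⟩
  exact bsdp_of_ainvs_of_bsdpPartner_of_congruences_of_analyticRank_le_one_hasseWeil hKO hBCS hGr h5 hGV hS hPR hmodP hmodL hGZK
    0 0 0 (-10716) 436468 hIW
    0 0 0 (-171) (-874) hIA
    5 11 16 3 8 (by norm_num) (by decide +kernel) card_t441864bo1_5 (by decide) (by decide)
    (by decide +kernel) card_t441864bo1_11 (by decide) (by decide +kernel) card_s25992c1_5 (by decide)
    hran hrA hbsdA hSchA hcertA hcong hC3

end Summit.BirchSwinnertonDyer.Rank1Residual.X9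

end
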